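import Summits.QuantumFields.YangMills.Theorems.SwapVirialDeficitBlowUpGnomonicLetterFloors
import Summits.QuantumFields.YangMills.Theorems.SwapVirialDeficitEndCoreProductFloor
import HarnessLib

/-!
# THE THREE-LETTER LEADER FLOOR OF THE END-CORE GAUSSIAN HALF: `B₀·|u|²/(1+x₀²+|u|²) + |y⊥|²/(1+y₀²+|y⊥|²) + |z|²/(1+|z|²) ≤ 55200·L⁶·F̂(hubAt δ 1)`
# on `|u|² ≤ 1 + x₀²`, `δ² ≤ 1/3` (stub `stub_core_end`, the pointwise-in-leaders hypothesis `hF` of ✓`lintegral_hubSlab_leader_le` with `r = B₀`;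
# free-hands support of ⟨stmt-QuantumFields-24197⟩ `SwapVirialDeficit.SwapGluedStiffness`; LEAD sfw-p2 g99 2026-08-31 21:56Z (a)(2), 22:22Z (B))

Packages LEAD's ✓`gnoDeficit_hubAt_ge_sigma_product` (the `u`-letters against `B`, with `B ≥ B₀(δ,x₀,y₀)` on the Gaussian half — erratum 21:56Z: the `y₀`-term
needs no halving) and w3 g67's ✓`gnoDeficit_floor_yPerp` (`4/(1+δ²) ≥ 3` on the end window) and ✓`gnoDeficit_floor_z` into ONE inequality whose three summands are
LITERALLY the three exponents of ✓`lintegral_hubSlab_leader_le` with `r = B₀`, `c₁ = c₂ = c₃`: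
* `endGauss_B_ge_B0` (`B ≥ B₀` on `|u|² ≤ 1+x₀²`), ★★ `endGauss_three_floor` (letters via ✓`normSq3_eq_three`).
So the caller's `hF` is: follower ceiling (w2 ✓`follower_laplace_ceiling`) at fixed leaders, then `e^{−b·m(ℓ)} ≤ e^{−(b/(55200L⁶))·(f_u+f_v+f_z)}` by this file.

HONEST LABEL: real arithmetic on landed inequalities; `stub_core_end` (assembly ⧗ LEAD GaussCore, followers w2), stubs core-tip ∕ 001-good, ⟨24197⟩ ∕ ⟨24194⟩ and every rung
OPEN; own crux ⟨22884⟩ OPEN (blocked-on ⟨19935⟩); the Yang–Mills mass gap is NOT proved; no summit is proved by a line.  THEOREMS ONLY (0 `def`, 0 `sorry`), standard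
axioms.  Width seat ym-line-sfw-p2-w3 g67 (cell ym-idea-1, free hands), `--supports stmt-QuantumFields-24197`.  References: [cite: Luscher1983, §2]; [folklore].
-/

set_option autoImplicit false

noncomputable section

open MeasureTheory Quaternion
open scoped BigOperators Quaternion
open Literature.MathematicalPhysics.QuantumFieldTheory hiding SU2
open Literature.MathematicalPhysics.QuantumLattice

namespace Summit.QuantumFields.YangMills.Theorems.SwapVirialDeficit.BlowUpRing

open Summit.QuantumFields.YangMills.Theorems.FemtoTransferGap
open Summit.QuantumFields.YangMills.Theorems.FemtoTransferGap.TT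
open Summit.QuantumFields.YangMills.Theorems.VirialFluxGap.RingDeficit
open Summit.QuantumFields.YangMills.Theorems.SwapVirialDeficit.SwapRing
open Summit.QuantumFields.YangMills.Theorems.SwapVirialDeficit.Gnomonic (normSq3)

variable {L : ℕ} [NeZero L]

omit [NeZero L] in
/-- ★ On the Gaussian half `|u|² ≤ 1 + x₀²`, LEAD's `u`-free rate is below the product-floor rate:
`B₀ = 16δ²/(1+δ²) + 8x₀²/((1+x₀²)(1+δ²)) + 4y₀²/(1+y₀²) ≤ 16δ²/(1+δ²) + 16(|x|²δ²+x₀²)/((1+|x|²)(1+δ²)) + 4|y|²/(1+|y|²) = B`. [folklore] -/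
theorem endGauss_B_ge_B0 {δ x₀ U y₀ Q Sx Sy : ℝ} (hU0 : 0 ≤ U) (hQ0 : 0 ≤ Q) (hU : U ≤ 1 + x₀ ^ 2) (hSx : Sx = x₀ ^ 2 + U) (hSy : Sy = y₀ ^ 2 + Q) :
    16 * δ ^ 2 / (1 + δ ^ 2) + 8 * x₀ ^ 2 / ((1 + x₀ ^ 2) * (1 + δ ^ 2)) + 4 * y₀ ^ 2 / (1 + y₀ ^ 2) ≤
      16 * (δ ^ 2 * (1 + δ ^ 2)⁻¹) + 16 * ((Sx * δ ^ 2 + x₀ ^ 2) * ((1 + Sx)⁻¹ * (1 + δ ^ 2)⁻¹)) + 4 * (Sy * (1 + Sy)⁻¹) := by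
  have hd : 0 < 1 + δ ^ 2 := by positivity
  have hx : 0 < 1 + x₀ ^ 2 := by positivity
  have hy : 0 < 1 + y₀ ^ 2 := by positivity
  have hSx0 : 0 < 1 + Sx := by rw [hSx]; positivity
  have hSy0 : 0 < 1 + Sy := by rw [hSy]; positivity
  have t1 : 16 * δ ^ 2 / (1 + δ ^ 2) = 16 * (δ ^ 2 * (1 + δ ^ 2)⁻¹) := by rw [div_eq_mul_inv]; ring
  have t2 : 8 * x₀ ^ 2 / ((1 + x₀ ^ 2) * (1 + δ ^ 2)) ≤ 16 * ((Sx * δ ^ 2 + x₀ ^ 2) * ((1 + Sx)⁻¹ * (1 + δ ^ 2)⁻¹)) := by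
    rw [show 16 * ((Sx * δ ^ 2 + x₀ ^ 2) * ((1 + Sx)⁻¹ * (1 + δ ^ 2)⁻¹)) = 16 * (Sx * δ ^ 2 + x₀ ^ 2) / ((1 + Sx) * (1 + δ ^ 2)) by
      rw [div_eq_mul_inv, mul_inv]; ring]
    rw [div_le_div_iff₀ (by positivity) (by positivity)]
    have h1 : 1 + Sx ≤ 2 * (1 + x₀ ^ 2) := by rw [hSx]; linarith
    have h2 : 0 ≤ Sx * δ ^ 2 := by rw [hSx]; positivity
    nlinarith [mul_nonneg (mul_nonneg h2 hx.le) hd.le, mul_nonneg (sq_nonneg x₀) hd.le, mul_le_mul_of_nonneg_left h1 (mul_nonneg (sq_nonneg x₀) hd.le)]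
  have t3 : 4 * y₀ ^ 2 / (1 + y₀ ^ 2) ≤ 4 * (Sy * (1 + Sy)⁻¹) := by
    rw [show 4 * (Sy * (1 + Sy)⁻¹) = 4 * Sy / (1 + Sy) by rw [div_eq_mul_inv]; ring, div_le_div_iff₀ hy hSy0]
    have : y₀ ^ 2 ≤ Sy := by rw [hSy]; linarith
    nlinarith
  linarith

/-- ★★ **THE THREE-LETTER LEADER FLOOR ON THE END-CORE GAUSSIAN HALF**: for `δ² ≤ 1/3` and `u₁² + u₂² ≤ 1 + x₀²` (`x = (x₀,u₁,u₂) = η.1.1`, `y = (y₀, y⊥) = η.1.2`,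
`z = η.2.1`, ANY followers),
`B₀(δ,x₀,y₀)·|u|²/(1+x₀²+|u|²) + |y⊥|²/(1+y₀²+|y⊥|²) + |z|²/(1+|z|²) ≤ 55200·L⁶·F̂(hubAt δ 1, ε, η)` — the exponents of ✓`lintegral_hubSlab_leader_le` (`r = B₀`).
[cite: Luscher1983, §2] -/
theorem endGauss_three_floor (δ : ℝ) (hδ : δ ^ 2 ≤ 1 / 3) (ε : GnoSign L) (η : GnoCoord L) (hu : (η.1.1 1) ^ 2 + (η.1.1 2) ^ 2 ≤ 1 + (η.1.1 0) ^ 2) :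
    (16 * δ ^ 2 / (1 + δ ^ 2) + 8 * (η.1.1 0) ^ 2 / ((1 + (η.1.1 0) ^ 2) * (1 + δ ^ 2)) + 4 * (η.1.2 0) ^ 2 / (1 + (η.1.2 0) ^ 2)) *
          ((η.1.1 1) ^ 2 + (η.1.1 2) ^ 2) / (1 + (η.1.1 0) ^ 2 + ((η.1.1 1) ^ 2 + (η.1.1 2) ^ 2)) +
        ((η.1.2 1) ^ 2 + (η.1.2 2) ^ 2) / (1 + (η.1.2 0) ^ 2 + ((η.1.2 1) ^ 2 + (η.1.2 2) ^ 2)) +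
        normSq3 η.2.1 / (1 + normSq3 η.2.1) ≤
      55200 * (L : ℝ) ^ 6 * gnoDeficit (fun _ => false) (fun _ => 1) (hubAt δ 1) ε η := by
  have ha : hubAt δ 1 ≠ 0 := hubAt_one_ne_zero δ
  have hP := NearFlat.gnoDeficit_hubAt_ge_sigma_product (L := L) δ ε η
  have hY := gnoDeficit_floor_yPerp (L := L) ha ε η
  have hZ := gnoDeficit_floor_z (L := L) ha ε η
  have hF0 : 0 ≤ gnoDeficit (fun _ => false) (fun _ => 1) (hubAt δ 1) ε η := gnoDeficit_nonneg _ _ _ _ _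
  obtain ⟨-, -, -, hn2⟩ := bfar_hubAt_facts δ
  have him : ‖(hubAt δ 1).im‖ ^ 2 = 1 := by rw [norm_im_hubAt_one]; norm_num
  rw [him, hn2] at hY
  rw [normSq3_eq_three, normSq3_eq_three] at hP
  -- letters
  set x₀ := η.1.1 0 with hx₀
  set U : ℝ := (η.1.1 1) ^ 2 + (η.1.1 2) ^ 2 with hUdef
  set y₀ := η.1.2 0 with hy₀
  set Q : ℝ := (η.1.2 1) ^ 2 + (η.1.2 2) ^ 2 with hQdef
  set Z : ℝ := normSq3 η.2.1 with hZdef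
  set F := gnoDeficit (fun _ => false) (fun _ => 1) (hubAt δ 1) ε η with hFdef
  set M : ℝ := (L : ℝ) ^ 6 with hM
  have hU0 : 0 ≤ U := by rw [hUdef]; positivity
  have hQ0 : 0 ≤ Q := by rw [hQdef]; positivity
  have hZ0 : 0 ≤ Z := by rw [hZdef, normSq3_eq_three]; positivity
  have hM0 : 0 < M := by rw [hM]; exact pow_pos (by exact_mod_cast NeZero.pos L) 6
  have eSy : y₀ ^ 2 + η.1.2 1 ^ 2 + η.1.2 2 ^ 2 = y₀ ^ 2 + Q := by rw [hQdef]; ring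
  have eZ : η.2.1 0 ^ 2 + η.2.1 1 ^ 2 + η.2.1 2 ^ 2 = Z := by rw [hZdef, normSq3_eq_three]; ring
  rw [eSy] at hY
  rw [eZ] at hZ
  clear_value x₀ U y₀ Q Z F M
  have hd : 0 < 1 + δ ^ 2 := by positivity
  have hd43 : 1 + δ ^ 2 ≤ 4 / 3 := by linarith
  have hSx : 0 < 1 + (x₀ ^ 2 + U) := by positivity
  have hSy : 0 < 1 + (y₀ ^ 2 + Q) := by positivity
  -- B ≥ B₀ ≥ 0
  set B₀ : ℝ := 16 * δ ^ 2 / (1 + δ ^ 2) + 8 * x₀ ^ 2 / ((1 + x₀ ^ 2) * (1 + δ ^ 2)) + 4 * y₀ ^ 2 / (1 + y₀ ^ 2) with hB₀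
  have hB : B₀ ≤ 16 * (δ ^ 2 * (1 + δ ^ 2)⁻¹) + 16 * (((x₀ ^ 2 + U) * δ ^ 2 + x₀ ^ 2) * ((1 + (x₀ ^ 2 + U))⁻¹ * (1 + δ ^ 2)⁻¹)) +
      4 * ((y₀ ^ 2 + Q) * (1 + (y₀ ^ 2 + Q))⁻¹) := by
    rw [hB₀]; exact endGauss_B_ge_B0 hU0 hQ0 hu rfl rfl
  have hB00 : 0 ≤ B₀ := by rw [hB₀]; positivity
  clear_value B₀
  -- the u-term: `B₀·U/(1+x₀²+U) ≤ (4/3)·39600·M·F`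
  have hu1 : B₀ * U / (1 + x₀ ^ 2 + U) ≤ 52800 * M * F := by
    -- `U·(1+Sx)⁻¹·(1+δ²)⁻¹·B ≥ U·(1+Sx)⁻¹·(3/4)·B₀`
    have h1 : U * ((1 + (x₀ ^ 2 + U))⁻¹ * (1 + δ ^ 2)⁻¹) * B₀ ≤ 39600 * M * F := by
      refine le_trans ?_ hP
      exact mul_le_mul_of_nonneg_left hB (by positivity)
    have h2 : (3 / 4) * (B₀ * U / (1 + x₀ ^ 2 + U)) ≤ U * ((1 + (x₀ ^ 2 + U))⁻¹ * (1 + δ ^ 2)⁻¹) * B₀ := by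
      have h3 : (3 / 4 : ℝ) ≤ (1 + δ ^ 2)⁻¹ := by rw [le_inv_comm₀ (by norm_num) hd]; linarith
      have e : U * ((1 + (x₀ ^ 2 + U))⁻¹ * (1 + δ ^ 2)⁻¹) * B₀ = (1 + δ ^ 2)⁻¹ * (B₀ * U / (1 + x₀ ^ 2 + U)) := by
        rw [div_eq_mul_inv, show 1 + x₀ ^ 2 + U = 1 + (x₀ ^ 2 + U) by ring]; ring
      rw [e]
      exact mul_le_mul_of_nonneg_right h3 (by positivity)
    linarith
  -- the y⊥-term: `Q/(1+y₀²+Q) ≤ 600·M·F`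
  have hy1 : Q / (1 + y₀ ^ 2 + Q) ≤ 600 * M * F := by
    have e : 4 * 1 * Q / ((1 + δ ^ 2) * (1 + (y₀ ^ 2 + Q))) = (4 / (1 + δ ^ 2)) * (Q / (1 + y₀ ^ 2 + Q)) := by
      rw [show 1 + y₀ ^ 2 + Q = 1 + (y₀ ^ 2 + Q) by ring]; field_simp
    rw [e] at hY
    have h3 : 3 ≤ 4 / (1 + δ ^ 2) := by rw [le_div_iff₀ hd]; linarith
    have hq : 0 ≤ Q / (1 + y₀ ^ 2 + Q) := by positivity
    nlinarith [mul_le_mul_of_nonneg_right h3 hq]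
  -- the z-term
  have hz1 : Z / (1 + Z) ≤ 1800 * M * F := hZ
  linarith
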